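import Mathlib
import Literature.Analysis.Complex.CauchyPompeiu
import Summits.SmoothPoincare4.SmoothPoincare4.Theorems.SullivanDualTameOrBrodyR4HelperConjugateBeltrami
import Summits.SmoothPoincare4.SmoothPoincare4.Theorems.SullivanDualTameOrBrodyR4HelperFarDeriv
import Summits.SmoothPoincare4.SmoothPoincare4.Theorems.SullivanDualTameOrBrodyR4HelperStructureInjective
import Summits.SmoothPoincare4.SmoothPoincare4.Theorems.SullivanDualTameOrBrodyR4HelperCompactDomination
import Summits.SmoothPoincare4.SmoothPoincare4.Theorems.SullivanDualTameOrBrodyR4HelperZeroFreeOfDbarLe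

/-!
# No critical points of a proper quasi-holomorphic self-map of `ℂ` of degree one at infinity (crux `TameOrBrodyR4`, stmt-SmoothPoincare4-7826, line `Sketch`, skeleton v13 — registered helper `helper_planarNoCriticalPoint`)

The planar heart of the reshaped transversality stub `stub_transversePencil` of Gromov's
anchored-pencil argument on `ℝ⁴`. Let `f : ℂ → ℂ` be `C^∞` and QUASI-HOLOMORPHIC for a `C^∞` field
`j` of complex structures on the target plane (`j η ∘ j η = -1`, `df_η (i v) = j η (df_η v)`), with
`j = i` and `f` holomorphic outside the disc of radius `ρ₁`, and normalised by `f η - η → 0` at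
infinity. Then `df_η` is injective for every `η` (no tangency of the curve with the pencil).

Proof (assembled from the landed helpers of the line): with `g := ∂ₓ f` the function
`G := ½ (g - i j g)` solves the conjugate Beltrami equation `∂̄ G = K(η) g`,
`K = ¼ (∂_y j + j ∂ₓ j)` (`helper_conjugateBeltrami`), `K` is continuous and vanishes where `j ≡ i`
(outside radius `ρ₁ + 1`), while `G = L(η) g` for the continuous field `L = ½ (1 - i j)` which is
pointwise injective because `j` is positively oriented (`helper_structureInjective`); compactness
turns this into `|∂̄ G| ≤ M |G|` (`helper_compactDomination`). Far out `G = g = f'` and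
`|f' - 1| < ½` (`helper_farDeriv`), so the δ-regularised similarity principle
(`helper_zeroFreeOfDbarLe`) shows `G` has no zero; a zero `v ≠ 0` of `df_η` would force
`df_η = 0` (its kernel is `i`-invariant), `g η = 0`, `G η = 0`.

References: L. Bers, L. Nirenberg (1954); I. N. Vekua, *Generalized analytic functions* (1962),
Ch. III (similarity principle); D. McDuff, D. Salamon, *J-holomorphic curves and symplectic
topology* (2012), §2.3 (Carleman similarity principle).
-/

-- the registered namespace `Summit.SmoothPoincare4.SmoothPoincare4.…` repeats a component
set_option linter.dupNamespace false

noncomputable section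

open scoped ContDiff Topology
open Filter Set Metric

namespace Summit.SmoothPoincare4.SmoothPoincare4.Cruxes.TameOrBrodyR4.Sketch

namespace PlanarNoCriticalPoint

/-- `C^∞` maps have `C^∞` differentials (order `∞` bookkeeping). -/
theorem contDiff_fderiv {E F : Type*} [NormedAddCommGroup E] [NormedSpace ℝ E]
    [NormedAddCommGroup F] [NormedSpace ℝ F] {u : E → F} (hu : ContDiff ℝ ∞ u) :
    ContDiff ℝ ∞ (fderiv ℝ u) :=
  (contDiff_infty_iff_fderiv.1 hu).2

/-- For a complex-differentiable `q`, the real differential is multiplication by the complex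
derivative: `dq_ξ ζ = ζ · q'(ξ)`. -/
theorem fderiv_real_apply {q : ℂ → ℂ} {ξ : ℂ} (hq : DifferentiableAt ℂ q ξ) (ζ : ℂ) :
    fderiv ℝ q ξ ζ = ζ * deriv q ξ := by
  rw [hq.fderiv_restrictScalars ℝ, ContinuousLinearMap.coe_restrictScalars', fderiv_eq_smul_deriv,
    smul_eq_mul]

/-- An `ℝ`-linear map on `ℂ` killing `v ≠ 0` and `i v` is zero. -/
theorem clm_eq_zero_of_apply_eq_zero (T : ℂ →L[ℝ] ℂ) {v : ℂ} (hv : v ≠ 0) (h1 : T v = 0)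
    (h2 : T (Complex.I * v) = 0) (ζ : ℂ) : T ζ = 0 := by
  have hζ : ζ = ((ζ / v).re : ℝ) • v + ((ζ / v).im : ℝ) • (Complex.I * v) := by
    rw [Complex.real_smul, Complex.real_smul]
    have e : ζ = (ζ / v) * v := by field_simp
    conv_lhs => rw [e, ← Complex.re_add_im (ζ / v)]
    ring
  rw [hζ, map_add, map_smul, map_smul, h1, h2, smul_zero, smul_zero, add_zero]

end PlanarNoCriticalPoint

open PlanarNoCriticalPoint in
/-- **Registered helper `helper_planarNoCriticalPoint` (the planar theorem behind the reshaped
transversality stub).** A `C^∞` map `f : ℂ → ℂ`, quasi-holomorphic for a `C^∞` field `j` of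
complex structures (`j² = -1`, `df (i v) = j (df v)`) that is standard (`j = i`, `f` holomorphic)
outside the disc of radius `ρ₁`, and normalised by `f η - η → 0` at infinity, has injective
differential at every point. -/
theorem helper_planarNoCriticalPoint (f : ℂ → ℂ) (j : ℂ → (ℂ →L[ℝ] ℂ)) (ρ₁ : ℝ)
    (hf : ContDiff ℝ ∞ f) (hj : ContDiff ℝ ∞ j)
    (hjj : ∀ η v, j η (j η v) = -v)
    (hstr : ∀ η v, fderiv ℝ f η (Complex.I * v) = j η (fderiv ℝ f η v))
    (hfar_j : ∀ η : ℂ, ρ₁ ≤ ‖η‖ → ∀ v, j η v = Complex.I * v)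
    (hfar_f : ∀ η : ℂ, ρ₁ ≤ ‖η‖ → DifferentiableAt ℂ f η)
    (hnorm : Tendsto (fun η => f η - η) (cocompact ℂ) (𝓝 0)) :
    ∀ η v, fderiv ℝ f η v = 0 → v = 0 := by
  -- the objects
  set g : ℂ → ℂ := fun η => fderiv ℝ f η 1 with hg
  set G : ℂ → ℂ := fun η => (2 : ℂ)⁻¹ * (fderiv ℝ f η 1 - Complex.I * j η (fderiv ℝ f η 1))
    with hG
  set r : ℂ → ℂ := fun η =>
    (4 : ℂ)⁻¹ * (fderiv ℝ j η Complex.I (fderiv ℝ f η 1) + j η (fderiv ℝ j η 1 (fderiv ℝ f η 1)))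
    with hr
  set K : ℂ → (ℂ →L[ℝ] ℂ) := fun η =>
    (4 : ℂ)⁻¹ • (fderiv ℝ j η Complex.I + (j η).comp (fderiv ℝ j η 1)) with hK
  set L : ℂ → (ℂ →L[ℝ] ℂ) := fun η =>
    (2 : ℂ)⁻¹ • (ContinuousLinearMap.id ℝ ℂ - Complex.I • j η) with hL
  have hKr : ∀ η, r η = K η (g η) := fun η => by
    simp only [hr, hK, hg, smul_apply, add_apply,
      ContinuousLinearMap.comp_apply, smul_eq_mul]
  have hLG : ∀ η, G η = L η (g η) := fun η => by
    simp only [hG, hL, hg, smul_apply, sub_apply,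
      ContinuousLinearMap.id_apply, smul_eq_mul]
  have hLapply : ∀ η v, L η v = (2 : ℂ)⁻¹ * (v - Complex.I * j η v) := fun η v => by
    simp only [hL, smul_apply, sub_apply,
      ContinuousLinearMap.id_apply, smul_eq_mul]
  -- smoothness
  have hjd : ContDiff ℝ ∞ (fderiv ℝ j) := contDiff_fderiv hj
  have hgs : ContDiff ℝ ∞ g := (contDiff_fderiv hf).clm_apply contDiff_const
  obtain ⟨hGs, hdbarG⟩ := helper_conjugateBeltrami f j hf hj hjj hstr
  have hrs : ContDiff ℝ ∞ r := by
    refine contDiff_const.mul (ContDiff.add ?_ ?_)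
    · exact (hjd.clm_apply contDiff_const).clm_apply hgs
    · exact hj.clm_apply ((hjd.clm_apply contDiff_const).clm_apply hgs)
  have hKc : Continuous K := by
    have h1 : Continuous fun η => fderiv ℝ j η Complex.I :=
      (hjd.continuous.clm_apply continuous_const)
    have h2 : Continuous fun η => (j η).comp (fderiv ℝ j η 1) :=
      hj.continuous.clm_comp (hjd.continuous.clm_apply continuous_const)
    exact (h1.add h2).const_smul ((4 : ℂ)⁻¹)
  have hLc : Continuous L := by
    have h1 : Continuous fun η => Complex.I • j η := hj.continuous.const_smul Complex.I
    have h2 : Continuous fun η => ContinuousLinearMap.id ℝ ℂ - Complex.I • j η :=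
      continuous_const.sub h1
    show Continuous fun η => (2 : ℂ)⁻¹ • (ContinuousLinearMap.id ℝ ℂ - Complex.I • j η)
    exact h2.const_smul ((2 : ℂ)⁻¹)
  -- `K` vanishes where `j` is locally standard
  have hK0 : ∀ η : ℂ, ρ₁ + 1 ≤ ‖η‖ → K η = 0 := by
    intro η hη
    have hopen : IsOpen {ζ : ℂ | ρ₁ < ‖ζ‖} := isOpen_lt continuous_const continuous_norm
    have hmem : η ∈ {ζ : ℂ | ρ₁ < ‖ζ‖} := by
      show ρ₁ < ‖η‖
      linarith
    have hev : j =ᶠ[𝓝 η] fun _ => Complex.I • ContinuousLinearMap.id ℝ ℂ := by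
      filter_upwards [hopen.mem_nhds hmem] with ζ hζ
      ext v
      rw [hfar_j ζ (le_of_lt hζ) v, smul_apply, ContinuousLinearMap.id_apply,
        smul_eq_mul]
    have hd0 : fderiv ℝ j η = 0 := by
      rw [hev.fderiv_eq]
      exact fderiv_const_apply _
    ext v
    simp only [hK, hd0, smul_apply, zero_apply, ContinuousLinearMap.comp_zero, add_zero,
      smul_zero]
  -- `L` is pointwise injective (positivity of the structure)
  have hLinj : ∀ η v, L η v = 0 → v = 0 := by
    intro η v hv
    rw [hLapply] at hv
    have hv' : v - Complex.I * j η v = 0 := by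
      rcases mul_eq_zero.1 hv with h | h
      · exact absurd h (inv_ne_zero two_ne_zero)
      · exact h
    exact helper_structureInjective j ρ₁ hj.continuous hjj hfar_j η v hv'
  -- compactness: `|∂̄ G| ≤ M |G|`
  obtain ⟨M, -, hM⟩ := helper_compactDomination K L (ρ₁ + 1) hKc hLc hK0 hLinj
  have hdbar : ∀ η, Literature.Analysis.Complex.dbarAlong 1 G η = r η := hdbarG
  have hbound : ∀ η, ‖r η‖ ≤ M * ‖G η‖ := fun η => by
    rw [hKr, hLG]; exact hM η (g η)
  -- far behaviour: `G = f'` and `|f' - 1| < 1/2`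
  obtain ⟨ρf, hρf1, -, hρf⟩ := helper_farDeriv f ρ₁ hfar_f hnorm
  set ρ₀ : ℝ := max ρf (ρ₁ + 1) with hρ₀
  have hsupp : ∀ η : ℂ, ρ₀ ≤ ‖η‖ → r η = 0 := fun η hη => by
    rw [hKr, hK0 η ((le_max_right _ _).trans hη), zero_apply]
  have hfarG : ∀ η : ℂ, ρ₀ ≤ ‖η‖ → ‖G η - 1‖ < 1 := by
    intro η hη
    have hη1 : ρ₁ ≤ ‖η‖ := by linarith [(le_max_right ρf (ρ₁ + 1)).trans hη]
    have hηf : ρf ≤ ‖η‖ := (le_max_left _ _).trans hη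
    have hGg : G η = deriv f η := by
      have e1 : G η = (2 : ℂ)⁻¹ * (g η - Complex.I * j η (g η)) := rfl
      rw [e1, hfar_j η hη1, hg]
      simp only
      rw [fderiv_real_apply (hfar_f η hη1), one_mul, ← mul_assoc, Complex.I_mul_I]
      ring
    rw [hGg]
    linarith [hρf η hηf]
  -- the similarity principle: `G` has no zero
  have hZ : ∀ η, G η ≠ 0 := helper_zeroFreeOfDbarLe G r M ρ₀ hGs hrs hdbar hbound hsupp hfarG
  -- conclusion: the kernel of `df` is `i`-invariant, so a non-trivial kernel kills `g` and `G`
  intro η v hv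
  by_contra hv0
  have h2 : fderiv ℝ f η (Complex.I * v) = 0 := by rw [hstr, hv, map_zero]
  have hg0 : g η = 0 := clm_eq_zero_of_apply_eq_zero (fderiv ℝ f η) hv0 hv h2 1
  have hG0 : G η = 0 := by rw [hLG, hg0, map_zero]
  exact hZ η hG0

end Summit.SmoothPoincare4.SmoothPoincare4.Cruxes.TameOrBrodyR4.Sketch
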